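import Summits.Ventures.PercRepro2.CaseOneJ1
import Summits.Ventures.PercRepro2.CaseOnePendantMark
import Summits.Ventures.PercRepro2.CaseOneRootsAndOPendantG
import Summits.Ventures.PercRepro2.CaseOneRootsAndLeafClasses

/-!
# `(J1)` itself on the structural classes (blind cell PercRepro2, p1 g19; CONJECTURES row 2′J1)

`(J1)` — the cross term of (HCOV), `γ · Cov_μ(σ_b, σ₃) ≥ Cov_μ(σ_b, X)` — is the sum of `(J1₁)` and
its root-swapped mirror (`jOne_of_jOneOne_of_mirror`, CaseOneJ1). Every class theorem for `(J1₁)`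
whose hypotheses are symmetric under `a₁ ↔ a₂` therefore gives `(J1)` on that class:
**`jOne_of_rootsOnly`**, **`jOne_of_rootsAndO`**, **`jOne_of_rootsAndB`** (the roots-and-mark
classes, any root multiplicities), **`jOne_of_leaf_at_o`**, **`jOne_of_leaf_at_b`**,
**`jOne_of_leaf_at_root`** (`a₃` pendant at a mark),
**`jOne_of_leaf_rootsOnly`**, **`jOne_of_leaf_rootsAndO`**, **`jOne_of_pendantRootsOnly`**,
**`jOne_of_pendantRootsAndO`** (`a₃` pendant at a root-only / roots-and-`o` vertex) and
**`jOne_of_rootsAndLeaf_rootsOnly`**, **`jOne_of_rootsAndLeaf_rootsAndO`** (the two-level classes) —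
every finite graph, every weight vector. Own code; standard axioms.
-/

namespace Summit.Ventures.PercRepro2

namespace CaseOne

section JOne
variable {V : Type*} {E : Type*} [Fintype E] [DecidableEq E] [Fintype V] [DecidableEq V]
  {R : Type*} [Field R] [LinearOrder R] [IsStrictOrderedRing R]
variable {ends : E → Sym2 V} {o a₁ a₂ a₃ b u v : V} {e₀ eo : E}

omit [Fintype E] [DecidableEq E] [Fintype V] [DecidableEq V] [Field R] [LinearOrder R]
  [IsStrictOrderedRing R] in
/-- A root-edge hypothesis is symmetric in the roots. -/
lemma root_swap {x : V} (hroot : ∀ e, x ∈ ends e → ends e = s(a₁, x) ∨ ends e = s(a₂, x)) :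
    ∀ e, x ∈ ends e → ends e = s(a₂, x) ∨ ends e = s(a₁, x) :=
  fun e he => (hroot e he).symm

omit [Fintype E] [DecidableEq E] [Fintype V] [DecidableEq V] [Field R] [LinearOrder R]
  [IsStrictOrderedRing R] in
/-- A root-edge hypothesis with an excepted edge is symmetric in the roots. -/
lemma root_swap' {x : V} {e₀ : E}
    (hroot : ∀ e, x ∈ ends e → e ≠ e₀ → ends e = s(a₁, x) ∨ ends e = s(a₂, x)) :
    ∀ e, x ∈ ends e → e ≠ e₀ → ends e = s(a₂, x) ∨ ends e = s(a₁, x) :=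
  fun e he hne => (hroot e he hne).symm

/-- **`(J1)` for the root-only class** (every edge at `a₃` joins a root, any multiplicities). -/
theorem jOne_of_rootsOnly (p : E → R) (hp : IsProbVec p)
    (hroot : ∀ e, a₃ ∈ ends e → ends e = s(a₁, a₃) ∨ ends e = s(a₂, a₃)) (h1 : a₁ ≠ a₃)
    (h2 : a₂ ≠ a₃) (o : V) (hb : b ≠ a₃) : JOne p ends o a₁ a₂ a₃ b :=
  jOne_of_jOneOne_of_mirror p ends o a₁ a₂ a₃ b (jOneOne_of_rootsOnly p hp hroot h1 o hb)
    (jOneOne_of_rootsOnly p hp (root_swap hroot) h2 o hb)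

/-- **`(J1)` for `a₃` adjacent to the roots (any multiplicities) and to `o`.** -/
theorem jOne_of_rootsAndO (p : E → R) (hp : IsProbVec p) (he₀ : ends e₀ = s(o, a₃))
    (hroot : ∀ e, a₃ ∈ ends e → e ≠ e₀ → ends e = s(a₁, a₃) ∨ ends e = s(a₂, a₃)) (ho : o ≠ a₃)
    (h1 : a₁ ≠ a₃) (h2 : a₂ ≠ a₃) (hb : b ≠ a₃) : JOne p ends o a₁ a₂ a₃ b :=
  jOne_of_jOneOne_of_mirror p ends o a₁ a₂ a₃ b
    (jOneOne_of_rootsAndO p hp he₀ hroot ho h1 h2 hb)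
    (jOneOne_of_rootsAndO p hp he₀ (root_swap' hroot) ho h2 h1 hb)

/-- **`(J1)` for `a₃` adjacent to the roots (any multiplicities) and to `b`.** -/
theorem jOne_of_rootsAndB (p : E → R) (hp : IsProbVec p) (he₀ : ends e₀ = s(b, a₃))
    (hroot : ∀ e, a₃ ∈ ends e → e ≠ e₀ → ends e = s(a₁, a₃) ∨ ends e = s(a₂, a₃)) (hb : b ≠ a₃)
    (h1 : a₁ ≠ a₃) (h2 : a₂ ≠ a₃) (ho : o ≠ a₃) : JOne p ends o a₁ a₂ a₃ b :=
  jOne_of_jOneOne_of_mirror p ends o a₁ a₂ a₃ b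
    (jOneOne_of_rootsAndB p hp he₀ hroot hb h1 h2 ho)
    (jOneOne_of_rootsAndB p hp he₀ (root_swap' hroot) hb h2 h1 ho)

/-- **`(J1)` for `a₃` pendant at `o`.** -/
theorem jOne_of_leaf_at_o (p : E → R) (hp : IsProbVec p) (hl : IsLeafAt ends o a₃ e₀)
    (h1 : a₁ ≠ a₃) (h2 : a₂ ≠ a₃) (hb : b ≠ a₃) : JOne p ends o a₁ a₂ a₃ b :=
  jOne_of_jOneOne_of_mirror p ends o a₁ a₂ a₃ b (jOneOne_of_leaf_at_o p hp hl a₁ a₂ b h1 h2 hb)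
    (jOneOne_of_leaf_at_o p hp hl a₂ a₁ b h2 h1 hb)

/-- **`(J1)` for `a₃` pendant at `b`.** -/
theorem jOne_of_leaf_at_b (p : E → R) (hp : IsProbVec p) (hl : IsLeafAt ends b a₃ e₀)
    (ho : o ≠ a₃) (h1 : a₁ ≠ a₃) (h2 : a₂ ≠ a₃) : JOne p ends o a₁ a₂ a₃ b :=
  jOne_of_jOneOne_of_mirror p ends o a₁ a₂ a₃ b (jOneOne_of_leaf_at_b p hp hl o a₁ a₂ ho h1 h2)
    (jOneOne_of_leaf_at_b p hp hl o a₂ a₁ ho h2 h1)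

/-- **`(J1)` for `a₃` pendant at the root `a₁`** (and, by the mirror, at `a₂`). -/
theorem jOne_of_leaf_at_root (p : E → R) (hp : IsProbVec p) (hl : IsLeafAt ends a₁ a₃ e₀)
    (ho : o ≠ a₃) (h2 : a₂ ≠ a₃) (hb : b ≠ a₃) : JOne p ends o a₁ a₂ a₃ b :=
  jOne_of_jOneOne_of_mirror p ends o a₁ a₂ a₃ b (jOneOne_of_leaf_at_a1 p hp hl o a₂ b ho h2 hb)
    (jOneOne_of_leaf_at_a2 p hp hl o a₂ b ho h2 hb)

/-- **`(J1)` for `a₃` pendant at a root-only vertex.** -/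
theorem jOne_of_leaf_rootsOnly (p : E → R) (hp : IsProbVec p) (hl : IsLeafAt ends u a₃ e₀)
    (ho : o ≠ a₃) (h1 : a₁ ≠ a₃) (h2 : a₂ ≠ a₃) (hb : b ≠ a₃)
    (hroot : ∀ e : {e : E // e ≠ e₀}, u ∈ restrictEnds ends e₀ e →
      restrictEnds ends e₀ e = s(a₁, u) ∨ restrictEnds ends e₀ e = s(a₂, u)) (hu1 : a₁ ≠ u)
    (hu2 : a₂ ≠ u) (hub : b ≠ u) : JOne p ends o a₁ a₂ a₃ b :=
  jOne_of_jOneOne_of_mirror p ends o a₁ a₂ a₃ b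
    (jOneOne_of_leaf_rootsOnly p hp hl ho h1 h2 hb hroot hu1 hub)
    (jOneOne_of_leaf_rootsOnly p hp hl ho h2 h1 hb (fun e he => (hroot e he).symm) hu2 hub)

variable {eo' : {e : E // e ≠ e₀}}

/-- **`(J1)` for `a₃` pendant at a roots-and-`o` vertex.** -/
theorem jOne_of_leaf_rootsAndO (p : E → R) (hp : IsProbVec p) (hl : IsLeafAt ends u a₃ e₀)
    (ho : o ≠ a₃) (h1 : a₁ ≠ a₃) (h2 : a₂ ≠ a₃) (hb : b ≠ a₃)
    (heo : restrictEnds ends e₀ eo' = s(o, u))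
    (hroot : ∀ e : {e : E // e ≠ e₀}, u ∈ restrictEnds ends e₀ e → e ≠ eo' →
      restrictEnds ends e₀ e = s(a₁, u) ∨ restrictEnds ends e₀ e = s(a₂, u))
    (hou : o ≠ u) (hu1 : a₁ ≠ u) (hu2 : a₂ ≠ u) (hub : b ≠ u) : JOne p ends o a₁ a₂ a₃ b :=
  jOne_of_jOneOne_of_mirror p ends o a₁ a₂ a₃ b
    (jOneOne_of_leaf_rootsAndO p hp hl ho h1 h2 hb heo hroot hou hu1 hu2 hub)
    (jOneOne_of_leaf_rootsAndO p hp hl ho h2 h1 hb heo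
      (fun e he hne => (hroot e he hne).symm) hou hu2 hu1 hub)

/-- **`(J1)` for `a₃` pendant at a root-only vertex, in `G`.** -/
theorem jOne_of_pendantRootsOnly (p : E → R) (hp : IsProbVec p)
    (h : IsPendantRootsOnlyAt ends a₁ a₂ u a₃ e₀) (hu2 : a₂ ≠ u) (ho : o ≠ a₃) (hb : b ≠ a₃)
    (hub : b ≠ u) : JOne p ends o a₁ a₂ a₃ b :=
  jOne_of_leaf_rootsOnly p hp h.leaf ho h.ne_a1' h.ne_a2' hb h.restrict h.ne_a1 hu2 hub

/-- **`(J1)` for `a₃` pendant at a roots-and-`o` vertex, in `G`.** -/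
theorem jOne_of_pendantRootsAndO (p : E → R) (hp : IsProbVec p)
    (h : IsPendantRootsAndOAt ends o a₁ a₂ u a₃ e₀ eo) (hb : b ≠ a₃) (hub : b ≠ u) :
    JOne p ends o a₁ a₂ a₃ b :=
  jOne_of_leaf_rootsAndO p hp h.leaf h.ne_o' h.ne_a1' h.ne_a2' hb (eo' := ⟨eo, h.eo_ne⟩) h.ends_o
    h.restrict h.ne_o h.ne_a1 h.ne_a2 hub

/-- **`(J1)` for `a₃` adjacent to the roots and to `v`, `v` root-only otherwise.** -/
theorem jOne_of_rootsAndLeaf_rootsOnly (p : E → R) (hp : IsProbVec p) (he₀ : ends e₀ = s(v, a₃))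
    (hroot : ∀ e, a₃ ∈ ends e → e ≠ e₀ → ends e = s(a₁, a₃) ∨ ends e = s(a₂, a₃))
    (hvroot : ∀ e, v ∈ ends e → e ≠ e₀ → ends e = s(a₁, v) ∨ ends e = s(a₂, v)) (hv : v ≠ a₃)
    (ho : o ≠ a₃) (h1 : a₁ ≠ a₃) (h2 : a₂ ≠ a₃) (hb : b ≠ a₃) (hv1 : a₁ ≠ v) (hv2 : a₂ ≠ v)
    (hvb : b ≠ v) : JOne p ends o a₁ a₂ a₃ b :=
  jOne_of_jOneOne_of_mirror p ends o a₁ a₂ a₃ b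
    (jOneOne_of_rootsAndLeaf_rootsOnly p hp he₀ hroot hvroot hv ho h1 h2 hb hv1 hvb)
    (jOneOne_of_rootsAndLeaf_rootsOnly p hp he₀ (root_swap' hroot) (root_swap' hvroot) hv ho h2
      h1 hb hv2 hvb)

/-- **`(J1)` for `a₃` adjacent to the roots and to `v`, `v` roots-and-`o` otherwise.** -/
theorem jOne_of_rootsAndLeaf_rootsAndO (p : E → R) (hp : IsProbVec p) (he₀ : ends e₀ = s(v, a₃))
    (hroot : ∀ e, a₃ ∈ ends e → e ≠ e₀ → ends e = s(a₁, a₃) ∨ ends e = s(a₂, a₃))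
    (heo : ends eo = s(o, v))
    (hvroot : ∀ e, v ∈ ends e → e ≠ e₀ → e ≠ eo → ends e = s(a₁, v) ∨ ends e = s(a₂, v))
    (hv : v ≠ a₃) (ho : o ≠ a₃) (h1 : a₁ ≠ a₃) (h2 : a₂ ≠ a₃) (hb : b ≠ a₃) (hov : o ≠ v)
    (hv1 : a₁ ≠ v) (hv2 : a₂ ≠ v) (hvb : b ≠ v) : JOne p ends o a₁ a₂ a₃ b :=
  jOne_of_jOneOne_of_mirror p ends o a₁ a₂ a₃ b
    (jOneOne_of_rootsAndLeaf_rootsAndO p hp he₀ hroot heo hvroot hv ho h1 h2 hb hov hv1 hvb)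
    (jOneOne_of_rootsAndLeaf_rootsAndO p hp he₀ (root_swap' hroot) heo
      (fun e he hne hne' => (hvroot e he hne hne').symm) hv ho h2 h1 hb hov hv2 hvb)

end JOne

end CaseOne

end Summit.Ventures.PercRepro2
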